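import Summits.ValiantsHypothesis.ValiantsHypothesis.Theorems.DivisionGapPerDivisionHardStubClosedWalkSumTorus
import Summits.ValiantsHypothesis.ValiantsHypothesis.Theorems.DivisionGapPerDivisionHardStubMagnetRigidAux
import Summits.ValiantsHypothesis.ValiantsHypothesis.Theorems.DivisionGapPerDivisionHardStubMagnetRigidKey

/-!
# Crux `DivisionGap.PerDivisionHard` (stmt-ValiantsHypothesis-5065), line `pair-descent-jss-endpoint` —
stub `stub_magnetRigid`: a priced cut under which the closed walk sum is rigid (the MAGNET)

Seat c8 of the line showed that the walk-sum cofactor, non-rigid under every ONE-SCALE generic cut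
(`stub_walkTwin`), becomes rigid under STEERED (multi-scale) prices: unequal rewards magnetise.  This file
certifies the first instance.  For `L ≥ 2` even, `R₀ ≠ ρ₀` and a gadget with `m ≥ 8` padding vertices we
exhibit prices `u ≥ 1` off the placed face `placedBlock eR eC` such that the price functional
`U(mo) = Σ_{e ∉ face} u e · mo e` has AT MOST ONE minimiser on the support of `closedWalkSum n L R₀ ρ₀ a₀`
(`stub_magnetRigid`; through `stub_pricedCut` this gives `HasSingleGPart`).

## The proof (parts 1–3 in `…StubMagnetRigidAux.lean` (pairing identity, face facts, choices, prices) and `…StubMagnetRigidKey.lean`)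

* (★) `magnet_pairing_walkExponent`: `⟨u, walkExponent⟩ + 3·RowRew + 3·ColRew = L·(3A + 3P) + Cost`, so —
  the prices vanishing on the face (`Finset.sum_filter_of_ne`) — minimising `U = ⟨u, ·⟩` over the closed
  non-backtracking walks means maximising `3RowRew + 3ColRew − Cost`.
* `magnet_choices`, `magnet_mem_face_padRow/padCol`, `magnet_prices`: padding columns `C_a ≠ C_b` (both
  `≠ a₀`, matched to neither `R₀` nor `ρ₀`) and padding rows `R₁ ≠ R₂ ∉ {R₀, ρ₀}` (matched to neither
  `C_a, C_b` nor `a₀`); prices `0` on the face, `u(R₁,a₀) = 100H³`, `u(R₂,a₀) = 30H²`,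
  `u(ρ₀,C_a) = u(ρ₀,C_b) = 5H` (`H = L/2`), `u(R₁,C_b) = 2`, and `1` on every other cell.
* `magnet_key`: the bouncing walk `Wa = (R₀, R₁, R₂, R₁, …; C_a, C_b, C_a, …)` is the UNIQUE maximiser
  (lexicographic dominance: visits of `R₁`, of `R₂`, of `C_a`, of `C_b`, then the phase).
* Assembly (this file): a minimiser `mo` is the exponent of a closed walk
  (`exists_walk_of_mem_support_closedWalkSum`); `Wa` is a closed non-backtracking walk whose monomial has
  coefficient `≥ 1` in the sum over `ℝ≥0`, so it lies in the support and `U(mo) ≤ U(Wa)`; passing to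
  `ℕ`-indexed rows/columns (`magnet_fin_sum_eq_range`) the key claim excludes the strict case, so the walk of
  `mo` is `Wa` and `mo = walkExponent Wa`.
-/

noncomputable section

-- `Summit.ValiantsHypothesis.ValiantsHypothesis.…` is the tree's mandated single-conjunct layout
-- (Sub = Summit), so the duplicated namespace component is intended.
set_option linter.dupNamespace false

namespace Summit.ValiantsHypothesis.ValiantsHypothesis.Theorems.DivisionGapPerDivisionHard

open MvPolynomial Literature.Computability.AlgebraicComplexity
open scoped NNReal BigOperators

/-- **stub_magnetRigid — a priced cut under which the closed walk sum is rigid (the MAGNET).**  Let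
`L ≥ 2` be even, `R₀ ≠ ρ₀`, and let the gadget have `m ≥ 8` padding vertices.  Then there are prices
`u ≥ 1` off the placed face such that the price `U(mo) = Σ_{e ∉ face} u e · mo e` has at most one
minimiser on the support of `closedWalkSum n L R₀ ρ₀ a₀`.  Construction (`magnet_choices`,
`magnet_prices`): padding columns `C_a ≠ C_b`, both `≠ a₀` and matched to neither `R₀` nor `ρ₀`, padding
rows `R₁ ≠ R₂ ∉ {R₀, ρ₀}` matched to neither `C_a, C_b` nor `a₀`; `u = 0` on the face, the tower
`u(R₁,a₀) = 100H³`, `u(R₂,a₀) = 30H²`, `u(ρ₀,C_a) = u(ρ₀,C_b) = 5H` (`H = L/2`), `u(R₁,C_b) = 2`, and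
`u = 1` elsewhere.  By (★) (`magnet_pairing_walkExponent`) minimising `U` over the closed non-backtracking
walks means maximising `3·RowRew + 3·ColRew − Cost`, and by the key claim (`magnet_key`) the bouncing walk
`R₀, R₁, R₂, R₁, …` through the columns `C_a, C_b, C_a, …` is the UNIQUE maximiser; it lies in the
support, so every minimiser is its exponent. [folklore] -/
theorem stub_magnetRigid :
    ∀ (b k m n L : ℕ) (eR eC : BlockV b k m ≃ Fin n) (R₀ ρ₀ a₀ : Fin n),
      Even L → 2 ≤ L → 8 ≤ m → R₀ ≠ ρ₀ →
      ∃ u : Fin n × Fin n → ℕ, (∀ e : Fin n × Fin n, e ∉ placedBlock eR eC → 1 ≤ u e) ∧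
        ∀ mo ∈ (closedWalkSum n L R₀ ρ₀ a₀).support, ∀ mo' ∈ (closedWalkSum n L R₀ ρ₀ a₀).support,
          (∀ x ∈ (closedWalkSum n L R₀ ρ₀ a₀).support,
            (∑ e ∈ (Finset.univ : Finset (Fin n × Fin n)).filter (fun e => e ∉ placedBlock eR eC),
                u e * mo e) ≤
              ∑ e ∈ (Finset.univ : Finset (Fin n × Fin n)).filter (fun e => e ∉ placedBlock eR eC),
                u e * x e) →
          (∀ x ∈ (closedWalkSum n L R₀ ρ₀ a₀).support,
            (∑ e ∈ (Finset.univ : Finset (Fin n × Fin n)).filter (fun e => e ∉ placedBlock eR eC),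
                u e * mo' e) ≤
              ∑ e ∈ (Finset.univ : Finset (Fin n × Fin n)).filter (fun e => e ∉ placedBlock eR eC),
                u e * x e) →
          mo = mo' := by
  classical
  intro b k m n L eR eC R₀ ρ₀ a₀ hEven hL2 hm h0ρ
  obtain ⟨H, hLH⟩ : ∃ H, L = 2 * H := by
    obtain ⟨r, hr⟩ := hEven
    exact ⟨r, by omega⟩
  have hH : 1 ≤ H := by omega
  /- the magnet indices and the seven distinguished rows / columns -/
  obtain ⟨sa, sb, t₁, t₂, hsab, h1sa, h1sb, h2sa, h2sb, h21, hgood⟩ :=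
    magnet_choices eR eC R₀ ρ₀ a₀ hm
  obtain ⟨hCa_a, hsa0, hsaρ⟩ := hgood sa (Or.inl rfl)
  obtain ⟨hCb_a, hsb0, hsbρ⟩ := hgood sb (Or.inr (Or.inl rfl))
  obtain ⟨ht1a, h10, h1ρ⟩ := hgood t₁ (Or.inr (Or.inr (Or.inl rfl)))
  obtain ⟨ht2a, h20, h2ρ⟩ := hgood t₂ (Or.inr (Or.inr (Or.inr rfl)))
  have hinjR : ∀ x y : Fin m, eR (Sum.inr (Sum.inr x)) = eR (Sum.inr (Sum.inr y)) → x = y :=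
    fun x y h => by simpa using eR.injective h
  have hinjC : ∀ x y : Fin m, eC (Sum.inr (Sum.inr x)) = eC (Sum.inr (Sum.inr y)) → x = y :=
    fun x y h => by simpa using eC.injective h
  obtain ⟨R₁, hR₁⟩ : ∃ x : Fin n, x = eR (Sum.inr (Sum.inr t₁)) := ⟨_, rfl⟩
  obtain ⟨R₂, hR₂⟩ : ∃ x : Fin n, x = eR (Sum.inr (Sum.inr t₂)) := ⟨_, rfl⟩
  obtain ⟨Ca, hCa⟩ : ∃ x : Fin n, x = eC (Sum.inr (Sum.inr sa)) := ⟨_, rfl⟩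
  obtain ⟨Cb, hCb⟩ : ∃ x : Fin n, x = eC (Sum.inr (Sum.inr sb)) := ⟨_, rfl⟩
  have h01 : R₀ ≠ R₁ := fun h => h10 (hR₁ ▸ h.symm)
  have h02 : R₀ ≠ R₂ := fun h => h20 (hR₂ ▸ h.symm)
  have h12 : R₁ ≠ R₂ := fun h => h21 (hinjR _ _ (hR₂ ▸ hR₁ ▸ h)).symm
  have h1ρ' : R₁ ≠ ρ₀ := hR₁ ▸ h1ρ
  have h2ρ' : R₂ ≠ ρ₀ := hR₂ ▸ h2ρ
  have hab : Ca ≠ Cb := fun h => hsab (hinjC _ _ (hCb ▸ hCa ▸ h))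
  have haa : Ca ≠ a₀ := hCa ▸ hCa_a
  have hba : Cb ≠ a₀ := hCb ▸ hCb_a
  -- the ten off-face cells
  have f1 : (R₁, a₀) ∉ placedBlock eR eC := by
    rw [hR₁, magnet_mem_face_padRow]
    exact fun h => ht1a h.symm
  have f2 : (R₂, a₀) ∉ placedBlock eR eC := by
    rw [hR₂, magnet_mem_face_padRow]
    exact fun h => ht2a h.symm
  have f3 : (ρ₀, Ca) ∉ placedBlock eR eC := by
    rw [hCa, magnet_mem_face_padCol]
    exact fun h => hsaρ h.symm
  have f4 : (ρ₀, Cb) ∉ placedBlock eR eC := by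
    rw [hCb, magnet_mem_face_padCol]
    exact fun h => hsbρ h.symm
  have f5 : (R₀, Ca) ∉ placedBlock eR eC := by
    rw [hCa, magnet_mem_face_padCol]
    exact fun h => hsa0 h.symm
  have f6 : (R₀, Cb) ∉ placedBlock eR eC := by
    rw [hCb, magnet_mem_face_padCol]
    exact fun h => hsb0 h.symm
  have f7 : (R₁, Ca) ∉ placedBlock eR eC := by
    rw [hR₁, hCa, magnet_mem_face_padRow]
    exact fun h => h1sa (hinjC _ _ h).symm
  have f8 : (R₁, Cb) ∉ placedBlock eR eC := by
    rw [hR₁, hCb, magnet_mem_face_padRow]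
    exact fun h => h1sb (hinjC _ _ h).symm
  have f9 : (R₂, Ca) ∉ placedBlock eR eC := by
    rw [hR₂, hCa, magnet_mem_face_padRow]
    exact fun h => h2sa (hinjC _ _ h).symm
  have f10 : (R₂, Cb) ∉ placedBlock eR eC := by
    rw [hR₂, hCb, magnet_mem_face_padRow]
    exact fun h => h2sb (hinjC _ _ h).symm
  /- the tower of prices -/
  have hHH : H ≤ H * H := Nat.le_mul_of_pos_left H hH
  have hHHH : H * H ≤ H * H * H := Nat.le_mul_of_pos_right (H * H) hH
  have hM4 : 13 * H < 3 * (5 * H) := by omega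
  have hM2 : 6 * H * (5 * H) + 6 * H * (5 * H) + 19 * H < 3 * (30 * H * H) := by nlinarith
  have hM1 : 6 * H * (30 * H * H) + 6 * H * (5 * H) + 6 * H * (5 * H) + 19 * H <
      3 * (100 * H * H * H) := by nlinarith
  have hM34pos : 1 ≤ 5 * H := by omega
  have hM2pos : 1 ≤ 30 * H * H := by nlinarith
  have hM1pos : 1 ≤ 100 * H * H * H := by nlinarith
  obtain ⟨u, hu0, hu1, hA1, hA2, hA0, hP1, hP2, hP0, h0a, h0b, h1a, h1b, h2a, h2b⟩ :=
    magnet_prices (placedBlock eR eC) R₀ R₁ R₂ ρ₀ a₀ Ca Cb (100 * H * H * H) (30 * H * H) (5 * H)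
      (5 * H) hM1pos hM2pos hM34pos hM34pos h01 h02 h12 h0ρ h1ρ' h2ρ' hab haa hba
      f1 f2 f3 f4 f5 f6 f7 f8 f9 f10
  refine ⟨u, fun e he => hu1 e he, ?_⟩
  -- `u` vanishes on the face, so the priced sum over off-face cells is the full pairing `⟨u, ·⟩`
  have hU : ∀ f : (Fin n × Fin n) →₀ ℕ,
      ∑ e ∈ (Finset.univ : Finset (Fin n × Fin n)).filter (fun e => e ∉ placedBlock eR eC),
        u e * f e = ∑ e, u e * f e := fun f =>
    Finset.sum_filter_of_ne fun e _ hne he => hne (by rw [hu0 e he, zero_mul])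
  /- the bouncing walk `Wa = (rowsA, colsA)` and its `ℕ`-indexed version `(rA, cA)` -/
  obtain ⟨rA, hrA⟩ : ∃ g : ℕ → Fin n, ∀ t, g t = if t = 0 then R₀ else if t % 2 = 1 then R₁ else R₂ :=
    ⟨_, fun _ => rfl⟩
  obtain ⟨cA, hcA⟩ : ∃ g : ℕ → Fin n, ∀ s, g s = if s % 2 = 0 then Ca else Cb := ⟨_, fun _ => rfl⟩
  obtain ⟨rowsA, hrowsA⟩ : ∃ f : Fin L → Fin n, ∀ t, f t = rA t.val := ⟨_, fun _ => rfl⟩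
  obtain ⟨colsA, hcolsA⟩ : ∃ f : Fin (L + 1) → Fin n, ∀ s, f s = cA s.val := ⟨_, fun _ => rfl⟩
  have hrA0 : rA 0 = R₀ := by rw [hrA, if_pos rfl]
  have hrA1 : ∀ j, rA (2 * j + 1) = R₁ := fun j => by
    rw [hrA, if_neg (by omega), if_pos (by omega)]
  have hrA2 : ∀ j, 1 ≤ j → rA (2 * j) = R₂ := fun j hj => by
    rw [hrA, if_neg (by omega), if_neg (by omega)]
  have hcA0 : ∀ j, cA (2 * j) = Ca := fun j => by rw [hcA, if_pos (by omega)]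
  have hcA1 : ∀ j, cA (2 * j + 1) = Cb := fun j => by rw [hcA, if_neg (by omega)]
  -- `Wa` is a closed non-backtracking walk based at `R₀`
  have hWA : IsClosedNBWalk L R₀ rowsA colsA := by
    refine ⟨fun h => ?_, ?_, fun t => ?_, fun t h => ?_, fun h => ?_⟩
    · rw [hrowsA]
      exact hrA0
    · rw [hcolsA, hcolsA, Fin.val_last, Fin.val_zero, hcA, hcA, if_pos (by omega),
        if_pos (by omega)]
    · rw [hcolsA, hcolsA, Fin.val_castSucc, Fin.val_succ, hcA, hcA]
      obtain ⟨j, hj | hj⟩ := Nat.even_or_odd' t.val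
      · rw [if_pos (by omega), if_neg (by omega)]
        exact hab
      · rw [if_neg (by omega), if_pos (by omega)]
        exact hab.symm
    · rw [hrowsA, hrowsA]
      show rA t.val ≠ rA (t.val + 1)
      obtain ⟨j, hj | hj⟩ := Nat.even_or_odd' t.val
      · rw [hj]
        rcases Nat.eq_zero_or_pos j with rfl | hjp
        · rw [Nat.mul_zero, hrA0, Nat.zero_add, show (1 : ℕ) = 2 * 0 + 1 by rfl, hrA1]
          exact h01
        · rw [hrA2 j hjp, hrA1]
          exact h12.symm
      · rw [hj, hrA1, show 2 * j + 1 + 1 = 2 * (j + 1) by ring, hrA2 (j + 1) (by omega)]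
        exact h12
    · rw [hrowsA, hrowsA]
      show rA (L - 1) ≠ rA 0
      rw [hrA0, show L - 1 = 2 * (H - 1) + 1 by omega, hrA1]
      exact h01.symm
  -- `Wa` lies in the support of the closed walk sum (its monomial has coefficient `≥ 1`)
  have hsuppA : walkExponent ρ₀ a₀ rowsA colsA ∈ (closedWalkSum n L R₀ ρ₀ a₀).support := by
    rw [MvPolynomial.mem_support_iff]
    unfold closedWalkSum
    rw [MvPolynomial.coeff_sum]
    apply ne_of_gt
    apply lt_of_lt_of_le zero_lt_one
    refine le_trans (le_of_eq ?_) (Finset.single_le_sum (fun p _ => zero_le)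
      (Finset.mem_filter.2 ⟨Finset.mem_univ (rowsA, colsA), hWA⟩))
    rw [MvPolynomial.coeff_monomial, if_pos rfl]
  /- every minimiser is the exponent of `Wa` -/
  have main : ∀ mo ∈ (closedWalkSum n L R₀ ρ₀ a₀).support,
      (∀ x ∈ (closedWalkSum n L R₀ ρ₀ a₀).support,
        (∑ e ∈ (Finset.univ : Finset (Fin n × Fin n)).filter (fun e => e ∉ placedBlock eR eC),
            u e * mo e) ≤
          ∑ e ∈ (Finset.univ : Finset (Fin n × Fin n)).filter (fun e => e ∉ placedBlock eR eC),
            u e * x e) →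
      mo = walkExponent ρ₀ a₀ rowsA colsA := by
    intro mo hmo hmin
    obtain ⟨rows, cols, hw, rfl⟩ := exists_walk_of_mem_support_closedWalkSum R₀ ρ₀ a₀ hmo
    have hle := hmin _ hsuppA
    rw [hU, hU] at hle
    -- (★) for the walk and for `Wa`
    have EP := magnet_pairing_walkExponent u ρ₀ a₀ rows cols hw.2.1
    have EA := magnet_pairing_walkExponent u ρ₀ a₀ rowsA colsA hWA.2.1
    -- `ℕ`-indexed versions of the walk
    obtain ⟨r, hr⟩ : ∃ g : ℕ → Fin n, ∀ t (h : t < L), g t = rows ⟨t, h⟩ :=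
      ⟨fun t => if h : t < L then rows ⟨t, h⟩ else R₀, fun t h => dif_pos h⟩
    obtain ⟨c, hc⟩ : ∃ g : ℕ → Fin n, ∀ s (h : s < L + 1), g s = cols ⟨s, h⟩ :=
      ⟨fun s => if h : s < L + 1 then cols ⟨s, h⟩ else R₀, fun s h => dif_pos h⟩
    have c1 : ∑ t : Fin L, u (rows t, a₀) = ∑ t ∈ Finset.range L, u (r t, a₀) :=
      magnet_fin_sum_eq_range _ _ fun t => by rw [hr t.val t.isLt]
    have c2 : ∑ t : Fin L, u (ρ₀, cols t.succ) = ∑ t ∈ Finset.range L, u (ρ₀, c (t.succ)) :=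
      magnet_fin_sum_eq_range _ (fun t => u (ρ₀, c (t + 1))) fun t => by
        rw [hc (t.val + 1) (by omega)]
        rfl
    have c3 : ∑ t : Fin L, (u (rows t, cols t.castSucc) + 2 * u (rows t, cols t.succ)) =
        ∑ t ∈ Finset.range L, (u (r t, c t) + 2 * u (r t, c (t + 1))) :=
      magnet_fin_sum_eq_range _ (fun t => u (r t, c t) + 2 * u (r t, c (t + 1))) fun t => by
        rw [hr t.val t.isLt, hc t.val (by omega), hc (t.val + 1) (by omega)]
        rfl
    have c4 : ∑ t : Fin L, u (rowsA t, a₀) = ∑ t ∈ Finset.range L, u (rA t, a₀) :=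
      magnet_fin_sum_eq_range _ _ fun t => by rw [hrowsA]
    have c5 : ∑ t : Fin L, u (ρ₀, colsA t.succ) = ∑ t ∈ Finset.range L, u (ρ₀, cA (t + 1)) :=
      magnet_fin_sum_eq_range _ (fun t => u (ρ₀, cA (t + 1))) fun t => by
        rw [hcolsA, Fin.val_succ]
    have c6 : ∑ t : Fin L, (u (rowsA t, colsA t.castSucc) + 2 * u (rowsA t, colsA t.succ)) =
        ∑ t ∈ Finset.range L, (u (rA t, cA t) + 2 * u (rA t, cA (t + 1))) :=
      magnet_fin_sum_eq_range _ (fun t => u (rA t, cA t) + 2 * u (rA t, cA (t + 1))) fun t => by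
        rw [hrowsA, hcolsA, hcolsA, Fin.val_castSucc, Fin.val_succ]
    rw [c1, c2, c3] at EP
    rw [c4, c5, c6] at EA
    -- the walk conditions, `ℕ`-indexed
    have hr0' : r 0 = R₀ := by
      rw [hr 0 (by omega)]
      exact hw.1 (by omega)
    have hrr' : ∀ t, t + 1 < L → r t ≠ r (t + 1) := by
      intro t ht
      rw [hr t (by omega), hr (t + 1) ht]
      exact hw.2.2.2.1 ⟨t, by omega⟩ ht
    have hcc' : ∀ s, s < L → c s ≠ c (s + 1) := by
      intro s hs
      rw [hc s (by omega), hc (s + 1) (by omega)]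
      exact hw.2.2.1 ⟨s, hs⟩
    have hcL' : c L = c 0 := by
      rw [hc L (by omega), hc 0 (by omega)]
      have h0 : (⟨0, by omega⟩ : Fin (L + 1)) = 0 := Fin.ext (by simp)
      rw [h0]
      exact hw.2.1
    -- the key claim
    rcases magnet_key u L H hLH hH R₀ R₁ R₂ ρ₀ a₀ Ca Cb (100 * H * H * H) (30 * H * H) (5 * H)
        (5 * H) h01 h02 h12 hab hA1 hA2 hA0 hP1 hP2 hP0 h0a h0b h1a h1b h2a h2b hM1 hM2 hM4 hM4
        rA cA hrA0 hrA1 hrA2 hcA0 hcA1 r c hr0' hrr' hcc' hcL' with hlt | ⟨hpr, hpc⟩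
    · -- strictly worse than `Wa`: contradicts minimality
      exfalso
      linarith
    · -- pinned: the walk IS `Wa`
      have hrows : rows = rowsA := by
        funext t
        calc rows t = r t.val := (hr t.val t.isLt).symm
          _ = rowsA t := by rw [hpr t.val t.isLt, hrowsA]
      have hcols : cols = colsA := by
        funext s
        calc cols s = c s.val := (hc s.val s.isLt).symm
          _ = colsA s := by rw [hpc s.val (by omega), hcolsA]
      rw [hrows, hcols]
  intro mo hmo mo' hmo' hmin hmin'
  rw [main mo hmo hmin, main mo' hmo' hmin']

end Summit.ValiantsHypothesis.ValiantsHypothesis.Theorems.DivisionGapPerDivisionHard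

end
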